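import Summits.QuantumFields.QCD.Theorems.QuarksAsStableActionStableActionBridgeFermionSlicePosDef
import Summits.QuantumFields.QCD.Theorems.QuarksAsStableActionStableActionBridgeFermionSliceContinuous
import Summits.QuantumFields.QCD.Theorems.HeatSlicedQuarksRobustYangMillsHandoverFermionSliceSqrt
import Mathlib.Analysis.CStarAlgebra.ContinuousFunctionalCalculus.Commute
import Mathlib.Analysis.Matrix.Order
import Mathlib.Analysis.SpecialFunctions.ContinuousFunctionalCalculus.Rpow.Basic
import HarnessLib

/-!
# Stub `stub_fermionSliceOp_sqrt` of line `twisted_trace_transfer` for crux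
# `QuarksAsStableAction.StableActionBridge` (item stmt-QuantumFields-9737)

Sub-goal B1 of the skeleton `StableActionBridge` (§8 E3, line `twisted_trace_transfer`): a CONTINUOUS
Hermitian square root of Lüscher's fermionic transfer operator.  E3 realises the transfer matrix
`T̂ = T̂_F^{1/2} T̂_U T̂_F^{1/2}` of lattice QCD with `r = 1` Wilson quarks (Smit (6.87)) as an `L²`
integral operator with Hermitian kernel `R(U) B(U,U') R(U')`; it needs, for all bare masses
`m_f > −1`, a map `U ↦ R(U)` on the spatial link configurations `U : GaugeConfig 3 S SU(3)` with

* `R` continuous in `U`;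
* `R(U)ᴴ = R(U)` and `R(U)² = T̂_F(U) = fermionSliceOp U mq`;
* `R(U)` in the bicommutant of `T̂_F(U)`: every matrix commuting with `T̂_F(U)` commutes with `R(U)`
  (in particular the fermion parity `(−1)^F`).

Proof.  `R(U) := CFC.sqrt (T̂_F(U))`, Mathlib's continuous-functional-calculus square root of a
non-negative element of the (scoped, `MatrixOrder`) star-ordered ring `Matrix _ _ ℂ`.
`T̂_F(U)` is positive definite (`Sketch.fermionSliceOp_posDef`), hence non-negative, so
`R(U)² = T̂_F(U)` (`CFC.sqrt_mul_sqrt_self`); `R(U) ≥ 0` (`CFC.sqrt_nonneg`), hence Hermitian;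
`R(U) = cfc √· (T̂_F(U))` (`CFC.sqrt_eq_cfc`) commutes with everything commuting with `T̂_F(U)`
(`Commute.cfc_nnreal`: `cfc f a` is a limit of polynomials in `a`); and `U ↦ cfc √· (T̂_F(U))` is
continuous because `U ↦ T̂_F(U)` is (`Sketch.continuous_fermionSliceOp`) and the isometric continuous
functional calculus of the C⋆-algebra `Matrix _ _ ℂ` (L²-operator norm, scoped
`Matrix.Norms.L2Operator`, whose topology is the entrywise one) is continuous in the operator
variable on non-negative elements for a function continuous on a neighbourhood of all the spectra
(`Continuous.cfc_nnreal_of_mem_nhdsSet` with the neighbourhood `Set.univ`; this step is the landed lemma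
`RobustYangMillsHandover.PinTheInfimum.FermionSliceSqrt.continuous_cfcSqrt` of the sibling file
`HeatSlicedQuarksRobustYangMillsHandoverFermionSliceSqrt`, reused here).

References: M. Lüscher, Commun. Math. Phys. 54 (1977) 283 [Luscher1977, pp. 283–292];
J. Smit, *Introduction to Quantum Fields on a Lattice*, §6.5 (6.87) [Smit2023].
Pure theorem file (no definitions); the generic matrix lemmas live in the sub-namespace
`StubFermionSliceOpSqrt`.
-/

noncomputable section

namespace Summit.QuantumFields.QCD.Cruxes.StableActionBridge.TwistedTraceTransfer

local notation "𝔾" => Matrix.specialUnitaryGroup (Fin 3) ℂ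

open MeasureTheory
open scoped InnerProductSpace ComplexConjugate Matrix BigOperators
open Literature.MathematicalPhysics.QuantumFieldTheory Literature.MathematicalPhysics.QuantumLattice

namespace StubFermionSliceOpSqrt

open scoped ComplexOrder MatrixOrder

/-- **The square root `CFC.sqrt A` of a complex matrix is Hermitian** (it is non-negative,
`CFC.sqrt_nonneg`; the junk value `0` for non-non-negative `A` is Hermitian as well). [folklore] -/
theorem cfcSqrt_conjTranspose {n : Type*} [Fintype n] [DecidableEq n] (A : Matrix n n ℂ) :
    (CFC.sqrt A)ᴴ = CFC.sqrt A :=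
  (Matrix.nonneg_iff_posSemidef.mp (CFC.sqrt_nonneg A)).isHermitian

/-- **The square root lies in the bicommutant**: every matrix `P` commuting with `A` commutes with
`CFC.sqrt A = cfc √· A` (`Commute.cfc_nnreal`: the continuous functional calculus of `A` is a limit
of polynomials in `A`; on matrices it is even a polynomial in `A`). [folklore] -/
theorem commute_cfcSqrt {n : Type*} [Fintype n] [DecidableEq n] {A P : Matrix n n ℂ}
    (h : P * A = A * P) : P * CFC.sqrt A = CFC.sqrt A * P := by
  rw [CFC.sqrt_eq_cfc]
  have hc : Commute A P := h.symm
  exact (hc.cfc_nnreal NNReal.sqrt).symm.eq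

end StubFermionSliceOpSqrt

open scoped ComplexOrder MatrixOrder in
/-- **Sub-goal B1 (registered stub `stub_fermionSliceOp_sqrt`): a continuous Hermitian square root
of Smit's fermionic transfer operator.**  For all bare masses `m_f > −1` there is a CONTINUOUS map
`U ↦ R(U)` on the spatial link configurations with `R(U)ᴴ = R(U)`,
`R(U)² = T̂_F(U) = fermionSliceOp U mq`, lying in the bicommutant of `T̂_F(U)` (it commutes with
every matrix commuting with `T̂_F(U)` — in particular with the fermion parity `(−1)^F`).
Witness `R(U) := CFC.sqrt (T̂_F(U))`: `T̂_F(U)` is positive definite (`Sketch.fermionSliceOp_posDef`)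
and continuous in `U` (`Sketch.continuous_fermionSliceOp`); continuity of `R` by the landed
`RobustYangMillsHandover.PinTheInfimum.FermionSliceSqrt.continuous_cfcSqrt` (continuity of the
isometric continuous functional calculus in the operator variable), the algebra by `CFC.sqrt_nonneg`,
`CFC.sqrt_mul_sqrt_self`, `Commute.cfc_nnreal`.
[cite: Luscher1977, pp. 283–292] [cite: Smit2023, §6.5 (6.87)] -/
theorem stub_fermionSliceOp_sqrt : ∀ (Nf S : ℕ) [NeZero S] (mq : Fin Nf → ℝ), (∀ f, -1 < mq f) →
    ∃ R : GaugeConfig 3 S 𝔾 → Matrix (Finset (SliceFermiIdx Nf S)) (Finset (SliceFermiIdx Nf S)) ℂ,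
      Continuous R ∧ ∀ U, (R U)ᴴ = R U ∧ R U * R U = fermionSliceOp U mq ∧
        ∀ P : Matrix (Finset (SliceFermiIdx Nf S)) (Finset (SliceFermiIdx Nf S)) ℂ,
          P * fermionSliceOp U mq = fermionSliceOp U mq * P → P * R U = R U * P := by
  intro Nf S _ mq hm
  have hT : ∀ U : GaugeConfig 3 S 𝔾, (fermionSliceOp U mq).PosSemidef := fun U =>
    (Sketch.fermionSliceOp_posDef Nf S U mq hm).posSemidef
  exact ⟨fun U => CFC.sqrt (fermionSliceOp U mq),
    RobustYangMillsHandover.PinTheInfimum.FermionSliceSqrt.continuous_cfcSqrt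
      (Sketch.continuous_fermionSliceOp Nf S mq hm) hT,
    fun U => ⟨StubFermionSliceOpSqrt.cfcSqrt_conjTranspose _,
      CFC.sqrt_mul_sqrt_self (fermionSliceOp U mq) (hT U).nonneg,
      fun _ hP => StubFermionSliceOpSqrt.commute_cfcSqrt hP⟩⟩

end Summit.QuantumFields.QCD.Cruxes.StableActionBridge.TwistedTraceTransfer

end
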